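import Literature.Probability.Percolation.BondLocallyMonotoneFKG
import Literature.Probability.Percolation.AnnulusCrossingBoundProofs
import Literature.Probability.Percolation.NewmanSchulman
import Literature.Probability.Percolation.CrossingChains
import Literature.Probability.Percolation.LatticeSymmetry
import Literature.Probability.Percolation.FourArmGarbanDocking
import HarnessLib
import Summits.CriticalPhenomena.CardyFormulaZ2.Theorems.CardyBoundaryCoulombGasStripClusterRatesCgGlueNolinTools

/-!
# Crux `StripClusterRates` (stmt-CriticalPhenomena-13878), line two-cluster-rate-is-stationary-gap, reshape 5 (lead c6):
the generalised-FKG step of stub `stub_cgGlueLocal`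

Support file (`--supports stmt-CriticalPhenomena-13878`). The confined block events `F⁺` (increasing) and `F⁻` (decreasing)
of the confined-gluing order transfer are LOCALLY MONOTONE with respect to the glue zones: `F⁺` does not look at the edges
crossed by the middle glue face box, `F⁻` does not look at the edges of the two outer glue boxes. Nolin's generalised FKG
inequality (`bondPercolation_locallyMonotone_fkg`) then glues the two monotone glue events `G⁺`, `G⁻` to `F⁺ ∩ F⁻` of both
blocks at the cost `P(G⁺) · P(G⁻)`.
-/

noncomputable section

open MeasureTheory Filter Topology Set
open Literature.Probability.LatticeModels Literature.Probability.Percolation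

namespace Summit.CriticalPhenomena.CardyFormulaZ2.Cruxes.StripClusterRates.TwoClusterRateIsStationaryGap

/-! ## §1 The confined block events are local: determining sets of pairs -/

/-- The bottom dumbbell as a finite set of sites. [folklore] -/
theorem nl_coe_KB (M b : ℕ) :
    (↑((rectangle M (3 * b + 2)).filter (fun z : Site 2 => (z 0 ≤ (b : ℤ) ∨ (M : ℤ) ≤ z 0 + b) → z 1 ≤ (b : ℤ))) : Set (Site 2)) =
      {z ∈ (rectangle M (3 * b + 2) : Set (Site 2)) | (z 0 ≤ (b : ℤ) ∨ (M : ℤ) ≤ z 0 + b) → z 1 ≤ (b : ℤ)} :=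
  Finset.coe_filter _ _

/-- The top dumbbell as a finite set of sites. [folklore] -/
theorem nl_coe_KT (M b : ℕ) :
    (↑((rectangle M (3 * b + 2)).filter (fun z : Site 2 => (z 0 ≤ (b : ℤ) ∨ (M : ℤ) ≤ z 0 + b) → 2 * (b : ℤ) + 2 ≤ z 1)) : Set (Site 2)) =
      {z ∈ (rectangle M (3 * b + 2) : Set (Site 2)) | (z 0 ≤ (b : ℤ) ∨ (M : ℤ) ≤ z 0 + b) → 2 * (b : ℤ) + 2 ≤ z 1} :=
  Finset.coe_filter _ _

/-- The middle dual dumbbell as a finite set of faces. [folklore] -/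
theorem nl_coe_KM (M b : ℕ) :
    (↑(((rectangle (M + 1) (3 * b + 1)).image (· + pt (-1) 0)).filter (fun z : Site 2 => (z 0 ≤ (b : ℤ) ∨ (M : ℤ) ≤ z 0 + b) → (b : ℤ) + 1 ≤ z 1 ∧ z 1 ≤ 2 * (b : ℤ))) : Set (Site 2)) =
      {z ∈ ((· + pt (-1) 0) '' (rectangle (M + 1) (3 * b + 1) : Set (Site 2))) | (z 0 ≤ (b : ℤ) ∨ (M : ℤ) ≤ z 0 + b) → (b : ℤ) + 1 ≤ z 1 ∧ z 1 ≤ 2 * (b : ℤ)} := by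
  ext z
  simp only [Finset.coe_filter, Set.mem_setOf_eq, Finset.mem_image, Set.mem_image, Finset.mem_coe]

/-- **`F⁺(M,b)` is determined by the pairs of sites of its four regions.** [folklore] -/
theorem nl_determinedBy_plus (M b : ℕ) :
    DeterminedBy (openCrossing {z ∈ (rectangle M (3 * b + 2) : Set (Site 2)) | (z 0 ≤ (b : ℤ) ∨ (M : ℤ) ≤ z 0 + b) → z 1 ≤ (b : ℤ)} (leftSide M (3 * b + 2) : Set (Site 2)) (rightSide M (3 * b + 2) : Set (Site 2)) ∩ tbCrossing b b ∩ openCrossing {z ∈ (rectangle M (3 * b + 2) : Set (Site 2)) | (z 0 ≤ (b : ℤ) ∨ (M : ℤ) ≤ z 0 + b) → 2 * (b : ℤ) + 2 ≤ z 1} (leftSide M (3 * b + 2) : Set (Site 2)) (rightSide M (3 * b + 2) : Set (Site 2)) ∩ (BondConfig.relabel (sym2Equiv (Site.shift (-pt 0 (2 * (b : ℤ) + 2))))) ⁻¹' tbCrossing b b)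
      ↑(((rectangle M (3 * b + 2)).filter (fun z : Site 2 => (z 0 ≤ (b : ℤ) ∨ (M : ℤ) ≤ z 0 + b) → z 1 ≤ (b : ℤ))) ∪ (rectangle b b) ∪ ((rectangle M (3 * b + 2)).filter (fun z : Site 2 => (z 0 ≤ (b : ℤ) ∨ (M : ℤ) ≤ z 0 + b) → 2 * (b : ℤ) + 2 ≤ z 1)) ∪ ((rectangle b b).image (· + pt 0 (2 * (b : ℤ) + 2)))).sym2 := by
  refine ((DeterminedBy.inter (DeterminedBy.inter (DeterminedBy.inter ?_ ?_) ?_) ?_))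
  · rw [← nl_coe_KB]
    exact nl_determinedBy_openCrossing (by intro z hz; simp only [Finset.mem_union]; tauto) _ _
  · exact nl_determinedBy_openCrossing (T := (((rectangle M (3 * b + 2)).filter (fun z : Site 2 => (z 0 ≤ (b : ℤ) ∨ (M : ℤ) ≤ z 0 + b) → z 1 ≤ (b : ℤ))) ∪ (rectangle b b) ∪ ((rectangle M (3 * b + 2)).filter (fun z : Site 2 => (z 0 ≤ (b : ℤ) ∨ (M : ℤ) ≤ z 0 + b) → 2 * (b : ℤ) + 2 ≤ z 1)) ∪ ((rectangle b b).image (· + pt 0 (2 * (b : ℤ) + 2))))) (by intro z hz; simp only [Finset.mem_union]; tauto) _ _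
  · rw [← nl_coe_KT]
    exact nl_determinedBy_openCrossing (by intro z hz; simp only [Finset.mem_union]; tauto) _ _
  · refine (nl_determinedBy_pre (PlanarDuality.determinedBy_openCrossing (rectangle b b) _ _) (pt 0 (2 * (b : ℤ) + 2))).mono ?_
    exact Finset.coe_subset.2 (Finset.sym2_mono (by intro z hz; simp only [Finset.mem_union]; tauto))

/-- **`F⁻(M,b)` is determined by the edges crossed by pairs of faces of the middle dumbbell.** [folklore] -/
theorem nl_determinedBy_minus (M b : ℕ) :
    DeterminedBy (dualConfig ⁻¹' openCrossing {z ∈ ((· + pt (-1) 0) '' (rectangle (M + 1) (3 * b + 1) : Set (Site 2))) | (z 0 ≤ (b : ℤ) ∨ (M : ℤ) ≤ z 0 + b) → (b : ℤ) + 1 ≤ z 1 ∧ z 1 ≤ 2 * (b : ℤ)} ((· + pt (-1) 0) '' (leftSide (M + 1) (3 * b + 1) : Set (Site 2))) ((· + pt (-1) 0) '' (rightSide (M + 1) (3 * b + 1) : Set (Site 2))))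
      ↑((((rectangle (M + 1) (3 * b + 1)).image (· + pt (-1) 0)).filter (fun z : Site 2 => (z 0 ≤ (b : ℤ) ∨ (M : ℤ) ≤ z 0 + b) → (b : ℤ) + 1 ≤ z 1 ∧ z 1 ≤ 2 * (b : ℤ))).sym2.preimage dualEdge dualEdge_bijective.injective.injOn) := by
  rw [← nl_coe_KM]
  exact nl_determinedBy_dual (nl_determinedBy_openCrossing subset_rfl _ _)

/-- `F⁺` is increasing. [folklore] -/
theorem nl_isUpperSet_plus (M b : ℕ) :
    IsUpperSet (openCrossing {z ∈ (rectangle M (3 * b + 2) : Set (Site 2)) | (z 0 ≤ (b : ℤ) ∨ (M : ℤ) ≤ z 0 + b) → z 1 ≤ (b : ℤ)} (leftSide M (3 * b + 2) : Set (Site 2)) (rightSide M (3 * b + 2) : Set (Site 2)) ∩ tbCrossing b b ∩ openCrossing {z ∈ (rectangle M (3 * b + 2) : Set (Site 2)) | (z 0 ≤ (b : ℤ) ∨ (M : ℤ) ≤ z 0 + b) → 2 * (b : ℤ) + 2 ≤ z 1} (leftSide M (3 * b + 2) : Set (Site 2)) (rightSide M (3 * b + 2) : Set (Site 2)) ∩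 (BondConfig.relabel (sym2Equiv (Site.shift (-pt 0 (2 * (b : ℤ) + 2))))) ⁻¹' tbCrossing b b) :=
  ((((isUpperSet_openCrossing _ _ _).inter (isUpperSet_tbCrossing b b)).inter (isUpperSet_openCrossing _ _ _)).inter
    (nl_isUpperSet_pre (isUpperSet_tbCrossing b b) _))

/-- `F⁻` is decreasing. [folklore] -/
theorem nl_isLowerSet_minus (M b : ℕ) :
    IsLowerSet (dualConfig ⁻¹' openCrossing {z ∈ ((· + pt (-1) 0) '' (rectangle (M + 1) (3 * b + 1) : Set (Site 2))) | (z 0 ≤ (b : ℤ) ∨ (M : ℤ) ≤ z 0 + b) → (b : ℤ) + 1 ≤ z 1 ∧ z 1 ≤ 2 * (b : ℤ)} ((· + pt (-1) 0) '' (leftSide (M + 1) (3 * b + 1) : Set (Site 2))) ((· + pt (-1) 0) '' (rightSide (M + 1) (3 * b + 1) : Set (Site 2)))) :=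
  nl_isLowerSet_dual (isUpperSet_openCrossing _ _ _)


/-! ## §2 The glue events are local to the glue zones and monotone -/

/-- `lrCrossingAt u M n` is determined by the pairs of any finite set of sites containing the box `u + [0,M]×[0,n]`. [folklore] -/
theorem nl_determinedBy_lrCrossingAt {T : Finset (Site 2)} (u : Site 2) (M n : ℕ)
    (h : (rectangle M n).image (· + u) ⊆ T) : DeterminedBy (lrCrossingAt u M n) ↑T.sym2 := by
  rw [lrCrossingAt, ← Finset.coe_image]
  exact nl_determinedBy_openCrossing h _ _

/-- A translated `tbCrossing M n` is determined by the pairs of any finite set of sites containing the box `u + [0,M]×[0,n]`.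
[folklore] -/
theorem nl_determinedBy_pre_tbCrossing {T : Finset (Site 2)} (u : Site 2) (M n : ℕ)
    (h : (rectangle M n).image (· + u) ⊆ T) :
    DeterminedBy ((BondConfig.relabel (sym2Equiv (Site.shift (-u)))) ⁻¹' tbCrossing M n) ↑T.sym2 :=
  (nl_determinedBy_pre (PlanarDuality.determinedBy_openCrossing (rectangle M n) _ _) u).mono
    (Finset.coe_subset.2 (Finset.sym2_mono h))

/-- Box inclusion `u' + [0,M']×[0,n'] ⊆ u + [0,M]×[0,n]` from the four coordinate inequalities. [folklore] -/
theorem nl_image_rectangle_subset {u u' : Site 2} {M n M' n' : ℕ} (h0 : u 0 ≤ u' 0) (h0' : u' 0 + M' ≤ u 0 + M)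
    (h1 : u 1 ≤ u' 1) (h1' : u' 1 + n' ≤ u 1 + n) :
    (rectangle M' n').image (· + u') ⊆ (rectangle M n).image (· + u) := by
  intro z hz
  rw [← Finset.mem_coe, Finset.coe_image, mem_image_rectangle_iff] at hz ⊢
  omega

/-- **`G⁺(M₁,b)` is determined by the pairs of sites of the two outer glue boxes.** [folklore] -/
theorem nl_determinedBy_gluePlus (M₁ b : ℕ) :
    DeterminedBy (lrCrossingAt (pt ((M₁ : ℤ) - b) 0) (3 * b + 2) b ∩ (BondConfig.relabel (sym2Equiv (Site.shift (-pt ((M₁ : ℤ) - b) 0)))) ⁻¹' tbCrossing b b ∩ (BondConfig.relabel (sym2Equiv (Site.shift (-pt ((M₁ : ℤ) + b + 2) 0)))) ⁻¹' tbCrossing b b ∩ lrCrossingAt (pt ((M₁ : ℤ) - b) (2 * (b : ℤ) + 2)) (3 * b + 2) b ∩ (BondConfig.relabel (sym2Equiv (Site.shift (-pt ((M₁ : ℤ) - b) (2 * (b : ℤ) + 2))))) ⁻¹' tbCrossing b b ∩ (BondConfig.relabel (sym2Equiv (Site.shift (-pt ((M₁ : ℤ) + b + 2) (2 * (b : ℤ)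 + 2))))) ⁻¹' tbCrossing b b)
      ↑((rectangle (3 * b + 2) b).image (· + pt ((M₁ : ℤ) - b) 0) ∪ (rectangle (3 * b + 2) b).image (· + pt ((M₁ : ℤ) - b) (2 * (b : ℤ) + 2))).sym2 := by
  have hb0 : (0 : ℤ) ≤ b := Nat.cast_nonneg b
  refine DeterminedBy.inter (DeterminedBy.inter (DeterminedBy.inter (DeterminedBy.inter (DeterminedBy.inter ?_ ?_) ?_) ?_) ?_) ?_
  · exact nl_determinedBy_lrCrossingAt _ _ _ (Finset.subset_union_left.trans' subset_rfl)
  · refine nl_determinedBy_pre_tbCrossing _ _ _ ((nl_image_rectangle_subset ?_ ?_ ?_ ?_).trans Finset.subset_union_left) <;>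
      (simp only [pt, Matrix.cons_val_zero, Matrix.cons_val_one, Matrix.cons_val_fin_one]; omega)
  · refine nl_determinedBy_pre_tbCrossing _ _ _ ((nl_image_rectangle_subset ?_ ?_ ?_ ?_).trans Finset.subset_union_left) <;>
      (simp only [pt, Matrix.cons_val_zero, Matrix.cons_val_one, Matrix.cons_val_fin_one]; omega)
  · exact nl_determinedBy_lrCrossingAt _ _ _ (Finset.subset_union_right.trans' subset_rfl)
  · refine nl_determinedBy_pre_tbCrossing _ _ _ ((nl_image_rectangle_subset ?_ ?_ ?_ ?_).trans Finset.subset_union_right) <;>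
      (simp only [pt, Matrix.cons_val_zero, Matrix.cons_val_one, Matrix.cons_val_fin_one]; omega)
  · refine nl_determinedBy_pre_tbCrossing _ _ _ ((nl_image_rectangle_subset ?_ ?_ ?_ ?_).trans Finset.subset_union_right) <;>
      (simp only [pt, Matrix.cons_val_zero, Matrix.cons_val_one, Matrix.cons_val_fin_one]; omega)

/-- **`G⁻(M₁,b)` is determined by the edges crossed by the pairs of faces of the middle glue box.** [folklore] -/
theorem nl_determinedBy_glueMinus (M₁ b : ℕ) :
    DeterminedBy (dualConfig ⁻¹' (lrCrossingAt (pt ((M₁ : ℤ) - b) ((b : ℤ) + 1)) (3 * b + 2) (b - 1) ∩ (BondConfig.relabel (sym2Equiv (Site.shift (-pt ((M₁ : ℤ) - b) ((b : ℤ) + 1))))) ⁻¹' tbCrossing b (b - 1) ∩ (BondConfig.relabel (sym2Equiv (Site.shift (-pt ((M₁ : ℤ) + b + 1) ((b : ℤ) + 1))))) ⁻¹' tbCrossing (b + 1) (b - 1)))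
      ↑(((rectangle (3 * b + 2) (b - 1)).image (· + pt ((M₁ : ℤ) - b) ((b : ℤ) + 1))).sym2.preimage dualEdge dualEdge_bijective.injective.injOn) := by
  have hb0 : (0 : ℤ) ≤ b := Nat.cast_nonneg b
  refine nl_determinedBy_dual (DeterminedBy.inter (DeterminedBy.inter ?_ ?_) ?_)
  · exact nl_determinedBy_lrCrossingAt _ _ _ subset_rfl
  · refine nl_determinedBy_pre_tbCrossing _ _ _ (nl_image_rectangle_subset ?_ ?_ ?_ ?_) <;>
      (simp only [pt, Matrix.cons_val_zero, Matrix.cons_val_one, Matrix.cons_val_fin_one]; omega)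
  · refine nl_determinedBy_pre_tbCrossing _ _ _ (nl_image_rectangle_subset ?_ ?_ ?_ ?_) <;>
      (simp only [pt, Matrix.cons_val_zero, Matrix.cons_val_one, Matrix.cons_val_fin_one]; omega)

/-- `G⁺` is increasing. [folklore] -/
theorem nl_isUpperSet_gluePlus (M₁ b : ℕ) :
    IsUpperSet (lrCrossingAt (pt ((M₁ : ℤ) - b) 0) (3 * b + 2) b ∩ (BondConfig.relabel (sym2Equiv (Site.shift (-pt ((M₁ : ℤ) - b) 0)))) ⁻¹' tbCrossing b b ∩ (BondConfig.relabel (sym2Equiv (Site.shift (-pt ((M₁ : ℤ) + b + 2) 0)))) ⁻¹' tbCrossing b b ∩ lrCrossingAt (pt ((M₁ : ℤ) - b) (2 * (b : ℤ) + 2)) (3 * b + 2) b ∩ (BondConfig.relabel (sym2Equiv (Site.shift (-pt ((M₁ : ℤ) - b) (2 * (b : ℤ) + 2))))) ⁻¹' tbCrossing b b ∩ (BondConfig.relabel (sym2Equiv (Site.shift (-pt ((M₁ : ℤ) + b + 2) (2 * (b : ℤ) + 2))))) ⁻¹' tbCrossing b b) :=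
  (((((isUpperSet_lrCrossingAt _ _ _).inter (nl_isUpperSet_pre (isUpperSet_tbCrossing _ _) _)).inter
    (nl_isUpperSet_pre (isUpperSet_tbCrossing _ _) _)).inter (isUpperSet_lrCrossingAt _ _ _)).inter
    (nl_isUpperSet_pre (isUpperSet_tbCrossing _ _) _)).inter (nl_isUpperSet_pre (isUpperSet_tbCrossing _ _) _)

/-- `G⁻` is decreasing. [folklore] -/
theorem nl_isLowerSet_glueMinus (M₁ b : ℕ) :
    IsLowerSet (dualConfig ⁻¹' (lrCrossingAt (pt ((M₁ : ℤ) - b) ((b : ℤ) + 1)) (3 * b + 2) (b - 1) ∩ (BondConfig.relabel (sym2Equiv (Site.shift (-pt ((M₁ : ℤ) - b) ((b : ℤ) + 1))))) ⁻¹' tbCrossing b (b - 1) ∩ (BondConfig.relabel (sym2Equiv (Site.shift (-pt ((M₁ : ℤ) + b + 1) ((b : ℤ) + 1))))) ⁻¹' tbCrossing (b + 1) (b - 1))) :=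
  nl_isLowerSet_dual (((isUpperSet_lrCrossingAt _ _ _).inter (nl_isUpperSet_pre (isUpperSet_tbCrossing _ _) _)).inter
    (nl_isUpperSet_pre (isUpperSet_tbCrossing _ _) _))


/-! ## §3 The glue zones do not meet the regions the block events read there -/

/-- Membership in the sites of the outer glue boxes, in coordinates. [folklore] -/
theorem nl_mem_UP {M₁ b : ℕ} {z : Site 2}
    (hz : z ∈ ((rectangle (3 * b + 2) b).image (· + pt ((M₁ : ℤ) - b) 0) ∪ (rectangle (3 * b + 2) b).image (· + pt ((M₁ : ℤ) - b) (2 * (b : ℤ) + 2)))) :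
    (M₁ : ℤ) - b ≤ z 0 ∧ z 0 ≤ (M₁ : ℤ) + 2 * b + 2 ∧ ((0 ≤ z 1 ∧ z 1 ≤ (b : ℤ)) ∨ (2 * (b : ℤ) + 2 ≤ z 1 ∧ z 1 ≤ 3 * (b : ℤ) + 2)) := by
  rcases Finset.mem_union.1 hz with h | h <;>
    rw [← Finset.mem_coe, Finset.coe_image, mem_image_rectangle_iff] at h <;>
    simp only [pt, Matrix.cons_val_zero, Matrix.cons_val_one, Matrix.cons_val_fin_one] at h <;> omega

/-- Membership in the faces of the middle glue box, in coordinates (`1 ≤ b`). [folklore] -/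
theorem nl_mem_UF {M₁ b : ℕ} (hb : 1 ≤ b) {z : Site 2}
    (hz : z ∈ ((rectangle (3 * b + 2) (b - 1)).image (· + pt ((M₁ : ℤ) - b) ((b : ℤ) + 1)))) :
    (M₁ : ℤ) - b ≤ z 0 ∧ z 0 ≤ (M₁ : ℤ) + 2 * b + 2 ∧ (b : ℤ) + 1 ≤ z 1 ∧ z 1 ≤ 2 * (b : ℤ) := by
  rw [← Finset.mem_coe, Finset.coe_image, mem_image_rectangle_iff] at hz
  simp only [pt, Matrix.cons_val_zero, Matrix.cons_val_one, Matrix.cons_val_fin_one] at hz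
  omega

/-- Membership in the four regions of `F⁺(M,b)`, in coordinates: an end-zone site has an extreme row. [folklore] -/
theorem nl_mem_KALL {M b : ℕ} {z : Site 2}
    (hz : z ∈ (((rectangle M (3 * b + 2)).filter (fun z : Site 2 => (z 0 ≤ (b : ℤ) ∨ (M : ℤ) ≤ z 0 + b) → z 1 ≤ (b : ℤ))) ∪ (rectangle b b) ∪ ((rectangle M (3 * b + 2)).filter (fun z : Site 2 => (z 0 ≤ (b : ℤ) ∨ (M : ℤ) ≤ z 0 + b) → 2 * (b : ℤ) + 2 ≤ z 1)) ∪ ((rectangle b b).image (· + pt 0 (2 * (b : ℤ) + 2))))) :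
    0 ≤ z 1 ∧ z 1 ≤ 3 * (b : ℤ) + 2 ∧ ((z 0 ≤ (b : ℤ) ∨ (M : ℤ) ≤ z 0 + b) → (z 1 ≤ (b : ℤ) ∨ 2 * (b : ℤ) + 2 ≤ z 1)) := by
  simp only [Finset.mem_union] at hz
  rcases hz with ((h | h) | h) | h
  · rw [Finset.mem_filter, mem_rectangle_iff] at h
    omega
  · rw [mem_rectangle_iff] at h
    omega
  · rw [Finset.mem_filter, mem_rectangle_iff] at h
    omega
  · rw [← Finset.mem_coe, Finset.coe_image, mem_image_rectangle_iff] at h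
    simp only [pt, Matrix.cons_val_zero, Matrix.cons_val_one, Matrix.cons_val_fin_one] at h
    omega

/-- Membership in the faces of `F⁻(M,b)`, in coordinates: an end-zone face has a middle row. [folklore] -/
theorem nl_mem_KM {M b : ℕ} {z : Site 2}
    (hz : z ∈ (((rectangle (M + 1) (3 * b + 1)).image (· + pt (-1) 0)).filter (fun z : Site 2 => (z 0 ≤ (b : ℤ) ∨ (M : ℤ) ≤ z 0 + b) → (b : ℤ) + 1 ≤ z 1 ∧ z 1 ≤ 2 * (b : ℤ)))) :
    -1 ≤ z 0 ∧ z 0 ≤ (M : ℤ) ∧ ((z 0 ≤ (b : ℤ) ∨ (M : ℤ) ≤ z 0 + b) → (b : ℤ) + 1 ≤ z 1 ∧ z 1 ≤ 2 * (b : ℤ)) := by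
  rw [Finset.mem_filter, ← Finset.mem_coe, Finset.coe_image, mem_image_rectangle_iff] at hz
  simp only [pt, Matrix.cons_val_zero, Matrix.cons_val_one, Matrix.cons_val_fin_one] at hz
  omega

/-- (D1) The middle glue faces avoid the regions of `F⁺` of block 1. [folklore] -/
theorem nl_disjoint_UF_KALL₁ {M₁ b : ℕ} (hb : 1 ≤ b) :
    Disjoint ((rectangle (3 * b + 2) (b - 1)).image (· + pt ((M₁ : ℤ) - b) ((b : ℤ) + 1)))
      (((rectangle M₁ (3 * b + 2)).filter (fun z : Site 2 => (z 0 ≤ (b : ℤ) ∨ (M₁ : ℤ) ≤ z 0 + b) → z 1 ≤ (b : ℤ))) ∪ (rectangle b b) ∪ ((rectangle M₁ (3 * b + 2)).filter (fun z : Site 2 => (z 0 ≤ (b : ℤ) ∨ (M₁ : ℤ) ≤ z 0 + b) → 2 * (b : ℤ) + 2 ≤ z 1)) ∪ ((rectangle b b).image (· + pt 0 (2 * (b : ℤ) + 2)))) := by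
  rw [Finset.disjoint_left]
  intro z hz hz'
  have h := nl_mem_UF hb hz
  have h' := nl_mem_KALL hz'
  omega

/-- (D2) The middle glue faces avoid the regions of `F⁺` of block 2 (translated by `(M₁+b+2, 0)`). [folklore] -/
theorem nl_disjoint_UF_KALL₂ {M₁ M₂ b : ℕ} (hb : 1 ≤ b) :
    Disjoint ((rectangle (3 * b + 2) (b - 1)).image (· + pt ((M₁ : ℤ) - b) ((b : ℤ) + 1)))
      ((((rectangle M₂ (3 * b + 2)).filter (fun z : Site 2 => (z 0 ≤ (b : ℤ) ∨ (M₂ : ℤ) ≤ z 0 + b) → z 1 ≤ (b : ℤ))) ∪ (rectangle b b) ∪ ((rectangle M₂ (3 * b + 2)).filter (fun z : Site 2 => (z 0 ≤ (b : ℤ) ∨ (M₂ : ℤ) ≤ z 0 + b) → 2 * (b : ℤ) + 2 ≤ z 1)) ∪ ((rectangle b b).image (· + pt 0 (2 * (b : ℤ) + 2)))).image (· + pt ((M₁ : ℤ) + b + 2) 0)) := by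
  rw [Finset.disjoint_left]
  intro z hz hz'
  have h := nl_mem_UF hb hz
  obtain ⟨w, hw, rfl⟩ := Finset.mem_image.1 hz'
  have h' := nl_mem_KALL hw
  simp only [Pi.add_apply, pt, Matrix.cons_val_zero, Matrix.cons_val_one, Matrix.cons_val_fin_one] at h
  omega

/-- (D3) The faces of `F⁻` of block 1 avoid the sites of the outer glue boxes. [folklore] -/
theorem nl_disjoint_KM₁_UP {M₁ b : ℕ} :
    Disjoint (((rectangle (M₁ + 1) (3 * b + 1)).image (· + pt (-1) 0)).filter (fun z : Site 2 => (z 0 ≤ (b : ℤ) ∨ (M₁ : ℤ) ≤ z 0 + b) → (b : ℤ) + 1 ≤ z 1 ∧ z 1 ≤ 2 * (b : ℤ)))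
      ((rectangle (3 * b + 2) b).image (· + pt ((M₁ : ℤ) - b) 0) ∪ (rectangle (3 * b + 2) b).image (· + pt ((M₁ : ℤ) - b) (2 * (b : ℤ) + 2))) := by
  rw [Finset.disjoint_left]
  intro z hz hz'
  have h := nl_mem_KM hz
  have h' := nl_mem_UP hz'
  omega

/-- (D4) The faces of `F⁻` of block 2 (translated) avoid the sites of the outer glue boxes. [folklore] -/
theorem nl_disjoint_KM₂_UP {M₁ M₂ b : ℕ} :
    Disjoint ((((rectangle (M₂ + 1) (3 * b + 1)).image (· + pt (-1) 0)).filter (fun z : Site 2 => (z 0 ≤ (b : ℤ) ∨ (M₂ : ℤ) ≤ z 0 + b) → (b : ℤ) + 1 ≤ z 1 ∧ z 1 ≤ 2 * (b : ℤ))).image (· + pt ((M₁ : ℤ) + b + 2) 0))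
      ((rectangle (3 * b + 2) b).image (· + pt ((M₁ : ℤ) - b) 0) ∪ (rectangle (3 * b + 2) b).image (· + pt ((M₁ : ℤ) - b) (2 * (b : ℤ) + 2))) := by
  rw [Finset.disjoint_left]
  intro z hz hz'
  obtain ⟨w, hw, rfl⟩ := Finset.mem_image.1 hz
  have h := nl_mem_KM hw
  have h' := nl_mem_UP hz'
  simp only [Pi.add_apply, pt, Matrix.cons_val_zero, Matrix.cons_val_one, Matrix.cons_val_fin_one] at h'
  omega

/-- (D5) The middle glue faces avoid the sites of the outer glue boxes. [folklore] -/
theorem nl_disjoint_UF_UP {M₁ b : ℕ} (hb : 1 ≤ b) :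
    Disjoint ((rectangle (3 * b + 2) (b - 1)).image (· + pt ((M₁ : ℤ) - b) ((b : ℤ) + 1)))
      ((rectangle (3 * b + 2) b).image (· + pt ((M₁ : ℤ) - b) 0) ∪ (rectangle (3 * b + 2) b).image (· + pt ((M₁ : ℤ) - b) (2 * (b : ℤ) + 2))) := by
  rw [Finset.disjoint_left]
  intro z hz hz'
  have h := nl_mem_UF hb hz
  have h' := nl_mem_UP hz'
  omega


/-! ## §4 Nolin's generalised FKG inequality for the two blocks and the two glue events -/

/-- Translation commutes with duality on events: `(E∘dual) + v = (E + v)∘dual`. [folklore] -/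
theorem nl_pre_dual (v : Site 2) (E : Set (BondConfig (Site 2))) :
    (BondConfig.relabel (sym2Equiv (Site.shift (-v)))) ⁻¹' (dualConfig ⁻¹' E) =
      dualConfig ⁻¹' ((BondConfig.relabel (sym2Equiv (Site.shift (-v)))) ⁻¹' E) := by
  ext ω
  simp only [Set.mem_preimage]
  rw [dualConfig_relabel_shift]

/-- A determining set contained in `X`, avoiding `B`, lies in `(X \ (A ∪ B)) ∪ A`. [folklore] -/
theorem nl_subset_sdiff_union {E X A B : Finset (Sym2 (Site 2))} (hEX : E ⊆ X) (hEB : Disjoint E B) :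
    (↑E : Set (Sym2 (Site 2))) ⊆ ↑(X \ (A ∪ B)) ∪ ↑A := by
  intro e he
  rw [Finset.mem_coe] at he
  by_cases hA : e ∈ A
  · exact Or.inr (Finset.mem_coe.2 hA)
  · refine Or.inl (Finset.mem_coe.2 (Finset.mem_sdiff.2 ⟨hEX he, ?_⟩))
    rw [Finset.mem_union, not_or]
    exact ⟨hA, Finset.disjoint_left.1 hEB he⟩

/-- **The generalised-FKG step of CG3b** (registered helper `cg_glue_nolin` of crux `StripClusterRates`, line
two-cluster-rate-is-stationary-gap, reshape 5): for the confined events `F(Mᵢ,b) = F⁺ ∩ F⁻` of block 1 and of block 2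
translated by `(M₁+b+2, 0)`, and the glue events `G⁺` (increasing, read on the outer glue boxes) and `G⁻` (decreasing, read on
the edges crossed by the middle glue face box), `P(F₁ ∩ F₂') · P(G⁺) · P(G⁻) ≤ P(F₁ ∩ F₂' ∩ G⁺ ∩ G⁻)` — Nolin's generalised FKG
inequality with `A⁺ = F⁺₁ ∩ F⁺₂'` (which does not read the middle glue edges) and `A⁻ = F⁻₁ ∩ F⁻₂'` (which does not read the outer
glue boxes). [cite: Nolin2008, §4.3 Lemma 13 (arXiv:0711.4948 Lemma 12)] -/
theorem cg_glue_nolin :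
    ∀ (M₁ M₂ b : ℕ), 1 ≤ b → ∀ F₁ F₂ Gp Gm : Set (BondConfig (Site 2)), F₁ = ((openCrossing {z ∈ (rectangle M₁ (3 * b + 2) : Set (Site 2)) | (z 0 ≤ (b : ℤ) ∨ (M₁ : ℤ) ≤ z 0 + b) → z 1 ≤ (b : ℤ)} (leftSide M₁ (3 * b + 2) : Set (Site 2)) (rightSide M₁ (3 * b + 2) : Set (Site 2)) ∩ tbCrossing b b ∩ openCrossing {z ∈ (rectangle M₁ (3 * b + 2) : Set (Site 2)) | (z 0 ≤ (b : ℤ) ∨ (M₁ : ℤ) ≤ z 0 + b) → 2 * (b : ℤ) + 2 ≤ z 1} (leftSide M₁ (3 * b + 2) : Set (Site 2)) (rightSide M₁ (3 * b + 2) : Set (Site 2)) ∩ (BondConfig.relabel (sym2Equiv (Site.shift (-pt 0 (2 * (b : ℤ) + 2))))) ⁻¹' tbCrossing b b) ∩ (dualConfig ⁻¹' openCrossing {z ∈ ((· + pt (-1) 0) '' (rectangle (M₁ + 1) (3 * b + 1) : Set (Site 2))) | (z 0 ≤ (b : ℤ) ∨ (M₁ : ℤ) ≤ z 0 + b) → (b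 : ℤ) + 1 ≤ z 1 ∧ z 1 ≤ 2 * (b : ℤ)} ((· + pt (-1) 0) '' (leftSide (M₁ + 1) (3 * b + 1) : Set (Site 2))) ((· + pt (-1) 0) '' (rightSide (M₁ + 1) (3 * b + 1) : Set (Site 2))))) → F₂ = ((openCrossing {z ∈ (rectangle M₂ (3 * b + 2) : Set (Site 2)) | (z 0 ≤ (b : ℤ) ∨ (M₂ : ℤ) ≤ z 0 + b) → z 1 ≤ (b : ℤ)} (leftSide M₂ (3 * b + 2) : Set (Site 2)) (rightSide M₂ (3 * b + 2) : Set (Site 2)) ∩ tbCrossing b b ∩ openCrossing {z ∈ (rectangle M₂ (3 * b + 2) : Set (Site 2)) | (z 0 ≤ (b : ℤ) ∨ (M₂ : ℤ) ≤ z 0 + b) → 2 * (b : ℤ) + 2 ≤ z 1} (leftSide M₂ (3 * b + 2) : Set (Site 2)) (rightSide M₂ (3 * b + 2) : Set (Site 2)) ∩ (BondConfig.relabel (sym2Equiv (Site.shift (-pt 0 (2 * (b : ℤ) + 2))))) ⁻¹' tbCrossing b b) ∩ (dualConfig ⁻¹' openCrossing {z ∈ ((· + pt (-1) 0) '' (rectangle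 (M₂ + 1) (3 * b + 1) : Set (Site 2))) | (z 0 ≤ (b : ℤ) ∨ (M₂ : ℤ) ≤ z 0 + b) → (b : ℤ) + 1 ≤ z 1 ∧ z 1 ≤ 2 * (b : ℤ)} ((· + pt (-1) 0) '' (leftSide (M₂ + 1) (3 * b + 1) : Set (Site 2))) ((· + pt (-1) 0) '' (rightSide (M₂ + 1) (3 * b + 1) : Set (Site 2))))) → Gp = (lrCrossingAt (pt ((M₁ : ℤ) - b) 0) (3 * b + 2) b ∩ (BondConfig.relabel (sym2Equiv (Site.shift (-pt ((M₁ : ℤ) - b) 0)))) ⁻¹' tbCrossing b b ∩ (BondConfig.relabel (sym2Equiv (Site.shift (-pt ((M₁ : ℤ) + b + 2) 0)))) ⁻¹' tbCrossing b b ∩ lrCrossingAt (pt ((M₁ : ℤ) - b) (2 * (b : ℤ) + 2)) (3 * b + 2) b ∩ (BondConfig.relabel (sym2Equiv (Site.shift (-pt ((M₁ : ℤ) - b) (2 * (b : ℤ) + 2))))) ⁻¹' tbCrossing b b ∩ (BondConfig.relabel (sym2Equiv (Site.shift (-pt ((M₁ : ℤ) + b + 2) (2 * (b : ℤ) + 2)))))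 ⁻¹' tbCrossing b b) → Gm = (dualConfig ⁻¹' (lrCrossingAt (pt ((M₁ : ℤ) - b) ((b : ℤ) + 1)) (3 * b + 2) (b - 1) ∩ (BondConfig.relabel (sym2Equiv (Site.shift (-pt ((M₁ : ℤ) - b) ((b : ℤ) + 1))))) ⁻¹' tbCrossing b (b - 1) ∩ (BondConfig.relabel (sym2Equiv (Site.shift (-pt ((M₁ : ℤ) + b + 1) ((b : ℤ) + 1))))) ⁻¹' tbCrossing (b + 1) (b - 1))) → (bondPercolation (zdGraph 2) half).real (F₁ ∩ (BondConfig.relabel (sym2Equiv (Site.shift (-pt ((M₁ : ℤ) + b + 2) 0)))) ⁻¹' F₂) * ((bondPercolation (zdGraph 2) half).real Gp * (bondPercolation (zdGraph 2) half).real Gm) ≤ (bondPercolation (zdGraph 2) half).real (F₁ ∩ (BondConfig.relabel (sym2Equiv (Site.shift (-pt ((M₁ : ℤ) + b + 2) 0)))) ⁻¹' F₂ ∩ Gp ∩ Gm) := by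
  intro M₁ M₂ b hb F₁ F₂ Gp Gm hF₁ hF₂ hGp hGm
  -- name the two halves of the block events and the four finite sets of pairs
  obtain ⟨Ap, hAp⟩ : ∃ Ap : Set (BondConfig (Site 2)),
      Ap = ((openCrossing {z ∈ (rectangle M₁ (3 * b + 2) : Set (Site 2)) | (z 0 ≤ (b : ℤ) ∨ (M₁ : ℤ) ≤ z 0 + b) → z 1 ≤ (b : ℤ)} (leftSide M₁ (3 * b + 2) : Set (Site 2)) (rightSide M₁ (3 * b + 2) : Set (Site 2)) ∩ tbCrossing b b ∩ openCrossing {z ∈ (rectangle M₁ (3 * b + 2) : Set (Site 2)) | (z 0 ≤ (b : ℤ) ∨ (M₁ : ℤ) ≤ z 0 + b) → 2 * (b : ℤ) + 2 ≤ z 1} (leftSide M₁ (3 * b + 2) : Set (Site 2)) (rightSide M₁ (3 * b + 2) : Set (Site 2)) ∩ (BondConfig.relabel (sym2Equiv (Site.shift (-pt 0 (2 * (b : ℤ) + 2))))) ⁻¹' tbCrossing b b) ∩ (BondConfig.relabel (sym2Equiv (Site.shift (-pt ((M₁ : ℤ) + b + 2) 0)))) ⁻¹' (openCrossing {z ∈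 (rectangle M₂ (3 * b + 2) : Set (Site 2)) | (z 0 ≤ (b : ℤ) ∨ (M₂ : ℤ) ≤ z 0 + b) → z 1 ≤ (b : ℤ)} (leftSide M₂ (3 * b + 2) : Set (Site 2)) (rightSide M₂ (3 * b + 2) : Set (Site 2)) ∩ tbCrossing b b ∩ openCrossing {z ∈ (rectangle M₂ (3 * b + 2) : Set (Site 2)) | (z 0 ≤ (b : ℤ) ∨ (M₂ : ℤ) ≤ z 0 + b) → 2 * (b : ℤ) + 2 ≤ z 1} (leftSide M₂ (3 * b + 2) : Set (Site 2)) (rightSide M₂ (3 * b + 2) : Set (Site 2)) ∩ (BondConfig.relabel (sym2Equiv (Site.shift (-pt 0 (2 * (b : ℤ) + 2))))) ⁻¹' tbCrossing b b)) := ⟨_, rfl⟩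
  obtain ⟨Am, hAm⟩ : ∃ Am : Set (BondConfig (Site 2)),
      Am = ((dualConfig ⁻¹' openCrossing {z ∈ ((· + pt (-1) 0) '' (rectangle (M₁ + 1) (3 * b + 1) : Set (Site 2))) | (z 0 ≤ (b : ℤ) ∨ (M₁ : ℤ) ≤ z 0 + b) → (b : ℤ) + 1 ≤ z 1 ∧ z 1 ≤ 2 * (b : ℤ)} ((· + pt (-1) 0) '' (leftSide (M₁ + 1) (3 * b + 1) : Set (Site 2))) ((· + pt (-1) 0) '' (rightSide (M₁ + 1) (3 * b + 1) : Set (Site 2)))) ∩ (BondConfig.relabel (sym2Equiv (Site.shift (-pt ((M₁ : ℤ) + b + 2) 0)))) ⁻¹' (dualConfig ⁻¹' openCrossing {z ∈ ((· + pt (-1) 0) '' (rectangle (M₂ + 1) (3 * b + 1) : Set (Site 2))) | (z 0 ≤ (b : ℤ) ∨ (M₂ : ℤ) ≤ z 0 + b) → (b : ℤ) + 1 ≤ z 1 ∧ z 1 ≤ 2 * (b : ℤ)} ((· + pt (-1) 0) '' (leftSide (M₂ + 1) (3 * b + 1) : Set (Site 2))) ((· + pt (-1) 0) '' (rightSide (M₂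 + 1) (3 * b + 1) : Set (Site 2))))) := ⟨_, rfl⟩
  obtain ⟨Ep, hEp⟩ : ∃ Ep : Finset (Sym2 (Site 2)),
      Ep = ((((rectangle M₁ (3 * b + 2)).filter (fun z : Site 2 => (z 0 ≤ (b : ℤ) ∨ (M₁ : ℤ) ≤ z 0 + b) → z 1 ≤ (b : ℤ))) ∪ (rectangle b b) ∪ ((rectangle M₁ (3 * b + 2)).filter (fun z : Site 2 => (z 0 ≤ (b : ℤ) ∨ (M₁ : ℤ) ≤ z 0 + b) → 2 * (b : ℤ) + 2 ≤ z 1)) ∪ ((rectangle b b).image (· + pt 0 (2 * (b : ℤ) + 2)))).sym2 ∪ ((((rectangle M₂ (3 * b + 2)).filter (fun z : Site 2 => (z 0 ≤ (b : ℤ) ∨ (M₂ : ℤ) ≤ z 0 + b) → z 1 ≤ (b : ℤ))) ∪ (rectangle b b) ∪ ((rectangle M₂ (3 * b + 2)).filter (fun z : Site 2 => (z 0 ≤ (b : ℤ) ∨ (M₂ : ℤ) ≤ z 0 + b) → 2 * (b : ℤ) + 2 ≤ z 1)) ∪ ((rectangle b b).image (· + pt 0 (2 * (b : ℤ) + 2)))).image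 (· + pt ((M₁ : ℤ) + b + 2) 0)).sym2) := ⟨_, rfl⟩
  obtain ⟨Em, hEm⟩ : ∃ Em : Finset (Sym2 (Site 2)),
      Em = ((((rectangle (M₁ + 1) (3 * b + 1)).image (· + pt (-1) 0)).filter (fun z : Site 2 => (z 0 ≤ (b : ℤ) ∨ (M₁ : ℤ) ≤ z 0 + b) → (b : ℤ) + 1 ≤ z 1 ∧ z 1 ≤ 2 * (b : ℤ))).sym2.preimage dualEdge dualEdge_bijective.injective.injOn ∪ (((((rectangle (M₂ + 1) (3 * b + 1)).image (· + pt (-1) 0)).filter (fun z : Site 2 => (z 0 ≤ (b : ℤ) ∨ (M₂ : ℤ) ≤ z 0 + b) → (b : ℤ) + 1 ≤ z 1 ∧ z 1 ≤ 2 * (b : ℤ))).image (· + pt ((M₁ : ℤ) + b + 2) 0)).sym2).preimage dualEdge dualEdge_bijective.injective.injOn) := ⟨_, rfl⟩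
  obtain ⟨Pf, hPf⟩ : ∃ Pf : Finset (Sym2 (Site 2)),
      Pf = ((rectangle (3 * b + 2) b).image (· + pt ((M₁ : ℤ) - b) 0) ∪ (rectangle (3 * b + 2) b).image (· + pt ((M₁ : ℤ) - b) (2 * (b : ℤ) + 2))).sym2 := ⟨_, rfl⟩
  obtain ⟨Mf, hMf⟩ : ∃ Mf : Finset (Sym2 (Site 2)),
      Mf = (((rectangle (3 * b + 2) (b - 1)).image (· + pt ((M₁ : ℤ) - b) ((b : ℤ) + 1))).sym2.preimage dualEdge dualEdge_bijective.injective.injOn) := ⟨_, rfl⟩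
  -- the conditioning event splits as increasing ∩ decreasing
  have hset : F₁ ∩ (BondConfig.relabel (sym2Equiv (Site.shift (-pt ((M₁ : ℤ) + b + 2) 0)))) ⁻¹' F₂ = Ap ∩ Am := by
    rw [hF₁, hF₂, hAp, hAm]
    exact Set.ext fun ω => ⟨fun h => ⟨⟨h.1.1, h.2.1⟩, h.1.2, h.2.2⟩, fun h => ⟨⟨h.1.1, h.2.1⟩, h.1.2, h.2.2⟩⟩
  -- monotonicity
  have hupA : IsUpperSet Ap := by
    rw [hAp]; exact (nl_isUpperSet_plus M₁ b).inter (nl_isUpperSet_pre (nl_isUpperSet_plus M₂ b) _)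
  have hlowA : IsLowerSet Am := by
    rw [hAm]; exact (nl_isLowerSet_minus M₁ b).inter (nl_isLowerSet_pre (nl_isLowerSet_minus M₂ b) _)
  have hupG : IsUpperSet Gp := by rw [hGp]; exact nl_isUpperSet_gluePlus M₁ b
  have hlowG : IsLowerSet Gm := by rw [hGm]; exact nl_isLowerSet_glueMinus M₁ b
  -- locality
  have dAp : DeterminedBy Ap ↑Ep := by
    rw [hAp, hEp, Finset.coe_union]
    exact ((nl_determinedBy_plus M₁ b).mono Set.subset_union_left).inter
      ((nl_determinedBy_pre (nl_determinedBy_plus M₂ b) _).mono Set.subset_union_right)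
  have dAm : DeterminedBy Am ↑Em := by
    rw [hAm, hEm, Finset.coe_union]
    refine ((nl_determinedBy_minus M₁ b).mono Set.subset_union_left).inter ?_
    rw [nl_pre_dual]
    refine (nl_determinedBy_dual (nl_determinedBy_pre ?_ _)).mono Set.subset_union_right
    rw [← nl_coe_KM]
    exact nl_determinedBy_openCrossing subset_rfl _ _
  have dGp : DeterminedBy Gp ↑Pf := by rw [hGp, hPf]; exact nl_determinedBy_gluePlus M₁ b
  have dGm : DeterminedBy Gm ↑Mf := by rw [hGm, hMf]; exact nl_determinedBy_glueMinus M₁ b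
  -- the glue zones avoid what the block events read there
  have hEpM : Disjoint Ep Mf := by
    rw [hEp, hMf]
    exact Finset.disjoint_union_left.2
      ⟨(nl_disjoint_preimage_dualEdge (nl_disjoint_UF_KALL₁ (M₁ := M₁) hb)).symm,
        (nl_disjoint_preimage_dualEdge (nl_disjoint_UF_KALL₂ (M₁ := M₁) (M₂ := M₂) hb)).symm⟩
  have hEmP : Disjoint Em Pf := by
    rw [hEm, hPf]
    exact Finset.disjoint_union_left.2
      ⟨nl_disjoint_preimage_dualEdge (nl_disjoint_KM₁_UP (M₁ := M₁) (b := b)),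
        nl_disjoint_preimage_dualEdge (nl_disjoint_KM₂_UP (M₁ := M₁) (M₂ := M₂) (b := b))⟩
  have hPM : Disjoint Pf Mf := by
    rw [hPf, hMf]; exact (nl_disjoint_preimage_dualEdge (nl_disjoint_UF_UP (M₁ := M₁) hb)).symm
  -- Nolin's inequality with S = (Ep ∪ Em) \ (Pf ∪ Mf), P = Pf, M = Mf
  have hSP : Disjoint ((Ep ∪ Em) \ (Pf ∪ Mf)) Pf := Finset.sdiff_disjoint.mono_right Finset.subset_union_left
  have hSM : Disjoint ((Ep ∪ Em) \ (Pf ∪ Mf)) Mf := Finset.sdiff_disjoint.mono_right Finset.subset_union_right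
  have dAp' : DeterminedBy Ap (↑((Ep ∪ Em) \ (Pf ∪ Mf)) ∪ ↑Pf) :=
    dAp.mono (nl_subset_sdiff_union Finset.subset_union_left hEpM)
  have dAm' : DeterminedBy Am (↑((Ep ∪ Em) \ (Pf ∪ Mf)) ∪ ↑Mf) := by
    have h := dAm.mono (nl_subset_sdiff_union (A := Mf) (B := Pf) (Finset.subset_union_right (s₁ := Ep) (s₂ := Em)) hEmP)
    rwa [Finset.union_comm Mf Pf] at h
  have key := bondPercolation_locallyMonotone_fkg (zdGraph 2) half hSP hSM hPM hupA hlowA hupG hlowG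
    dAp' dAm' dGp dGm
  rw [hset, Set.inter_assoc (Ap ∩ Am) Gp Gm]
  exact key

end Summit.CriticalPhenomena.CardyFormulaZ2.Cruxes.StripClusterRates.TwoClusterRateIsStationaryGap

end
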